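import Summits.Langlands.Langlands.Theses.QuarterDeficit1951
import Literature.NumberTheory.GaloisRepresentations.GaloisRepUnramifiedProofs
import Literature.NumberTheory.GaloisRepresentations.TateUnramifiedLiftingHolds
import Literature.NumberTheory.GaloisRepresentations.DirichletCharacterOfGaloisCharacter
import Literature.FieldTheory.AlgClosed.PadicAlgClEquivComplex
import Literature.NumberTheory.Automorphic.BCDTTheoremBWildAtThreeDet

/-!
# Route `QuarterDeficit1951` (Langlands) — crux `IcosahedralSupply`: stub `stub_conductor`

Forward conductor computation for a framed representation `ρ : Γ_ℚ → GL₂(k)` with open kernel,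
unramified away from one place `v₀ ∣ p`, whose inertia groups above `v₀` act as
`P · diag(1, η) · P⁻¹` with `η` non-trivial of order prime to `p`:
`a_{v₀}(ρ) = codim V^{I} + Swan = 1 + 0` and `a_v(ρ) = 0` for `v ≠ v₀`, so the numerical Artin
conductor is `p` (Serre, *Local Fields*, Ch. VI §2, Cor. 1').
-/

set_option linter.dupNamespace false

noncomputable section

open scoped NumberField MatrixGroups
open Field IsDedekindDomain Polynomial
open Literature.NumberTheory.GaloisRepresentations Literature.NumberTheory.PAdicHodge

namespace Summit.Langlands.Langlands.Theorems.QuarterDeficit1951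

/-! ## Wild ramification acts through elements of `p`-power order -/

/-- An element `σ` of a wild ramification group `Γ_K^u(𝔓)`, `u > 0`, at a prime `𝔓 ∣ v ∣ p`, is
mapped by a framed representation `ρ` with open kernel to an element of `p`-power order:
`ρ (σ ^ p ^ k) = 1` for some `k`.  The action of `Γ_K` on the `Γ_K`-set `GL_n(A)` through `ρ` has
the open pointwise stabiliser `ker ρ`, so it factors through a finite Galois group in which `σ`
lands in the `p`-group `G₁` (the tree's `exists_pow_prime_pow_smul_eq_self`; Serre,
*Corps locaux*, IV §2, Cor. 3 of Prop. 7). [folklore] -/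
theorem exists_map_pow_prime_pow_eq_one_of_mem_absUpperRamificationSubgroup
    {K : Type*} [Field K] [NumberField K] {A : Type*} [CommRing A] [TopologicalSpace A] {n : ℕ}
    (ρ : FramedGaloisRep K A n)
    (hker : IsOpen ((ρ.toMonoidHom.ker : Subgroup (absoluteGaloisGroup K)) :
      Set (absoluteGaloisGroup K)))
    {v : HeightOneSpectrum (𝓞 K)} {𝔓 : Ideal (absIntegers (𝓞 K) K)} (h𝔓 : 𝔓 ∈ v.primesAbove)
    {p : ℕ} (hpv : (p : 𝓞 K) ∈ v.asIdeal) {u : ℝ} (hu : 0 < u) {σ : absoluteGaloisGroup K}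
    (hσ : σ ∈ absUpperRamificationSubgroup (𝓞 K) 𝔓 u) :
    ∃ k : ℕ, ρ (σ ^ p ^ k) = 1 := by
  letI : MulAction (absoluteGaloisGroup K) (GL (Fin n) A) := MulAction.compHom _ ρ.toMonoidHom
  have hopen : IsOpen {τ : absoluteGaloisGroup K | ∀ x : GL (Fin n) A, τ • x = x} := by
    have hset : {τ : absoluteGaloisGroup K | ∀ x : GL (Fin n) A, τ • x = x} =
        ((ρ.toMonoidHom.ker : Subgroup (absoluteGaloisGroup K)) : Set (absoluteGaloisGroup K)) := by
      ext τ
      simp only [Set.mem_setOf_eq, SetLike.mem_coe, MonoidHom.mem_ker]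
      constructor
      · intro hτ
        have h1 := hτ 1
        change ρ τ * 1 = 1 at h1
        rw [mul_one] at h1
        exact h1
      · intro hτ x
        change ρ τ = 1 at hτ
        change ρ τ * x = x
        rw [hτ, one_mul]
    rw [hset]
    exact hker
  obtain ⟨k, hk⟩ :=
    Literature.NumberTheory.Automorphic.BCDT.exists_pow_prime_pow_smul_eq_self h𝔓 hpv hu hσ
      (GL (Fin n) A) hopen
  refine ⟨k, ?_⟩
  have h1 := hk 1
  change ρ (σ ^ p ^ k) * 1 = 1 at h1
  rwa [mul_one] at h1

/-! ## The shape `P · diag(1, η) · P⁻¹` -/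

/-- If `P · diag(1, x) · P⁻¹ = 1` for an invertible `P`, then `x = 1`. [folklore] -/
theorem eq_one_of_conj_diagonal_eq_one {A : Type*} [CommRing A] (P : GL (Fin 2) A) {x : A}
    (h : (P : Matrix (Fin 2) (Fin 2) A) * Matrix.diagonal ![(1 : A), x] *
      ((P⁻¹ : GL (Fin 2) A) : Matrix (Fin 2) (Fin 2) A) = 1) : x = 1 := by
  have hPP : ((P⁻¹ : GL (Fin 2) A) : Matrix (Fin 2) (Fin 2) A) * (P : Matrix (Fin 2) (Fin 2) A)
      = 1 := by
    rw [← Units.val_mul, inv_mul_cancel, Units.val_one]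
  have hD : Matrix.diagonal ![(1 : A), x] = 1 := by
    calc Matrix.diagonal ![(1 : A), x]
        = ((P⁻¹ : GL (Fin 2) A) : Matrix (Fin 2) (Fin 2) A) *
            ((P : Matrix (Fin 2) (Fin 2) A) * Matrix.diagonal ![(1 : A), x] *
              ((P⁻¹ : GL (Fin 2) A) : Matrix (Fin 2) (Fin 2) A)) * (P : Matrix (Fin 2) (Fin 2) A) := by
          rw [Matrix.mul_assoc, Matrix.mul_assoc, hPP, Matrix.mul_one, ← Matrix.mul_assoc, hPP,
            Matrix.one_mul]
      _ = 1 := by rw [h, Matrix.mul_one, hPP]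
  have h11 := congr_fun (congr_fun hD 1) 1
  simpa using h11

/-- `P · diag(1, 1) · P⁻¹ = 1`. [folklore] -/
theorem conj_diagonal_one_one_eq_one {A : Type*} [CommRing A] (P : GL (Fin 2) A) :
    (P : Matrix (Fin 2) (Fin 2) A) * Matrix.diagonal ![(1 : A), 1] *
      ((P⁻¹ : GL (Fin 2) A) : Matrix (Fin 2) (Fin 2) A) = 1 := by
  have h1 : Matrix.diagonal ![(1 : A), 1] = 1 := by
    ext i j; fin_cases i <;> fin_cases j <;> simp
  rw [h1, Matrix.mul_one, ← Units.val_mul, mul_inv_cancel, Units.val_one]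

/-- The first column `P e₀` of `P` is fixed by every `P · diag(1, x) · P⁻¹`. [folklore] -/
theorem conj_diagonal_mulVec_col_zero {A : Type*} [CommRing A] (P : GL (Fin 2) A) (x : A) :
    ((P : Matrix (Fin 2) (Fin 2) A) * Matrix.diagonal ![(1 : A), x] *
        ((P⁻¹ : GL (Fin 2) A) : Matrix (Fin 2) (Fin 2) A)).mulVec
      ((P : Matrix (Fin 2) (Fin 2) A).mulVec (Pi.single 0 1)) =
      (P : Matrix (Fin 2) (Fin 2) A).mulVec (Pi.single 0 1) := by
  have hPP : ((P⁻¹ : GL (Fin 2) A) : Matrix (Fin 2) (Fin 2) A) * (P : Matrix (Fin 2) (Fin 2) A)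
      = 1 := by
    rw [← Units.val_mul, inv_mul_cancel, Units.val_one]
  rw [Matrix.mulVec_mulVec, Matrix.mul_assoc, hPP, Matrix.mul_one, ← Matrix.mulVec_mulVec,
    Matrix.diagonal_mulVec_single]
  simp

/-- The first column `P e₀` of an invertible `P` is non-zero (over a non-trivial ring). [folklore] -/
theorem mulVec_col_zero_ne_zero {A : Type*} [CommRing A] [Nontrivial A] (P : GL (Fin 2) A) :
    (P : Matrix (Fin 2) (Fin 2) A).mulVec (Pi.single 0 1) ≠ 0 := by
  intro h
  have hPP : ((P⁻¹ : GL (Fin 2) A) : Matrix (Fin 2) (Fin 2) A) * (P : Matrix (Fin 2) (Fin 2) A)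
      = 1 := by
    rw [← Units.val_mul, inv_mul_cancel, Units.val_one]
  have h2 : (Pi.single 0 1 : Fin 2 → A) =
      ((P⁻¹ : GL (Fin 2) A) : Matrix (Fin 2) (Fin 2) A).mulVec
        ((P : Matrix (Fin 2) (Fin 2) A).mulVec (Pi.single 0 1)) := by
    rw [Matrix.mulVec_mulVec, hPP, Matrix.one_mulVec]
  rw [h, Matrix.mulVec_zero] at h2
  have h3 := congr_fun h2 0
  simp at h3

/-! ## Tameness: Swan conductor `0` -/

/-- **Inertia of shape `P · diag(1, η) · P⁻¹` with `η` of order prime to `p` is tame.**  For a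
framed representation `ρ : Γ_K → GL₂(A)` with open kernel and a prime `𝔓 ∣ v ∣ p` of `\bar ℤ_K`
on whose inertia group `ρ` is `τ ↦ P · diag(1, η τ) · P⁻¹` with `p ∤ ord(η τ)`: every wild
ramification group `Γ_K^u(𝔓)`, `u > 0`, acts trivially on `Fin 2 → A`.  Indeed `σ ∈ Γ_K^u(𝔓)`
lies in `I_𝔓` (`absUpperRamificationSubgroup_le_inertia_holds`) and `ρ(σ^{p^k}) = 1` for some
`k` (`exists_map_pow_prime_pow_eq_one_of_mem_absUpperRamificationSubgroup`), so
`ord(η σ) ∣ p^k` is coprime to `p^k`, `η σ = 1` and `ρ σ = 1`.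
Ref: Serre, *Local Fields*, Ch. IV §2, Cor. 3 of Prop. 7 and Ch. VI §2. [folklore] -/
theorem isTameAt_of_inertia_shape {K : Type*} [Field K] [NumberField K] {A : Type*} [CommRing A]
    [TopologicalSpace A] [IsTopologicalRing A] (ρ : FramedGaloisRep K A 2)
    (hker : IsOpen ((ρ.toMonoidHom.ker : Subgroup (absoluteGaloisGroup K)) :
      Set (absoluteGaloisGroup K)))
    {p : ℕ} {v : HeightOneSpectrum (𝓞 K)} (hpv : (p : 𝓞 K) ∈ v.asIdeal)
    {𝔓 : Ideal (absIntegers (𝓞 K) K)} (h𝔓 : 𝔓 ∈ v.primesAbove) (P : GL (Fin 2) A)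
    (η : 𝔓.inertia (absoluteGaloisGroup K) →* Aˣ)
    (hPη : ∀ τ : 𝔓.inertia (absoluteGaloisGroup K),
      ((ρ (τ : absoluteGaloisGroup K) : GL (Fin 2) A) : Matrix (Fin 2) (Fin 2) A) =
        (P : Matrix (Fin 2) (Fin 2) A) * Matrix.diagonal ![(1 : A), (η τ : A)] *
          ((P⁻¹ : GL (Fin 2) A) : Matrix (Fin 2) (Fin 2) A))
    (hcop : ∀ τ, p.Coprime (orderOf (η τ))) :
    ρ.toGaloisRep.IsTameAt (𝓞 K) 𝔓 := by
  intro u hu σ hσ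
  have hσI : σ ∈ 𝔓.inertia (absoluteGaloisGroup K) :=
    absUpperRamificationSubgroup_le_inertia_holds (𝓞 K) 𝔓 u (K := K) hσ
  obtain ⟨k, hk⟩ :=
    exists_map_pow_prime_pow_eq_one_of_mem_absUpperRamificationSubgroup ρ hker h𝔓 hpv hu hσ
  set τ : 𝔓.inertia (absoluteGaloisGroup K) := ⟨σ, hσI⟩ with hτdef
  -- `η τ ^ p ^ k = 1`
  have hηk : η τ ^ p ^ k = 1 := by
    have h1 : ((ρ ((τ ^ p ^ k : 𝔓.inertia (absoluteGaloisGroup K)) : absoluteGaloisGroup K) :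
        GL (Fin 2) A) : Matrix (Fin 2) (Fin 2) A) = 1 := by
      rw [Subgroup.coe_pow, hk, Units.val_one]
    rw [hPη (τ ^ p ^ k), map_pow] at h1
    have h2 := eq_one_of_conj_diagonal_eq_one P h1
    rwa [Units.val_pow_eq_pow_val, ← Units.val_pow_eq_pow_val, Units.val_eq_one] at h2
  -- the order of `η τ` divides `p ^ k` and is prime to it
  have hone : η τ = 1 := by
    have hdvd : orderOf (η τ) ∣ p ^ k := orderOf_dvd_of_pow_eq_one hηk
    have hco : (orderOf (η τ)).Coprime (p ^ k) := (Nat.Coprime.pow_left k (hcop τ)).symm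
    exact orderOf_eq_one_iff.mp (hco.eq_one_of_dvd hdvd)
  -- hence `ρ σ = 1`
  have hρσ : ρ σ = 1 := by
    have h1 := hPη τ
    rw [hone, Units.val_one, conj_diagonal_one_one_eq_one] at h1
    exact Units.ext h1
  refine LinearMap.ext fun w => ?_
  change ((ρ σ : GL (Fin 2) A) : Matrix (Fin 2) (Fin 2) A).mulVec w = w
  rw [hρσ, Units.val_one, Matrix.one_mulVec]

/-! ## The tame part: `codim V^{I} = 1` -/

/-- **`codim V^{I_𝔓} = 1` for inertia of shape `P · diag(1, η) · P⁻¹` with `η` non-trivial**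
(`ρ : Γ_K → GL₂(k)` framed over a field `k`): the fixed subspace of `I_𝔓` contains the non-zero
vector `P e₀` and is not everything (some `η τ₀ ≠ 1`, so `ρ τ₀ ≠ 1`), hence is a line, and
`codim = 2 - 1 = 1`.  Ref: Serre, *Local Fields*, Ch. VI §2, Cor. 1' ("`codim V^{G_0}`"). [folklore] -/
theorem codimFixed_inertia_eq_one_of_shape {K : Type*} [Field K] {k : Type*} [Field k]
    [TopologicalSpace k] [IsTopologicalRing k] (ρ : FramedGaloisRep K k 2)
    {𝔓 : Ideal (absIntegers (𝓞 K) K)} (P : GL (Fin 2) k)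
    (η : 𝔓.inertia (absoluteGaloisGroup K) →* kˣ)
    (hPη : ∀ τ : 𝔓.inertia (absoluteGaloisGroup K),
      ((ρ (τ : absoluteGaloisGroup K) : GL (Fin 2) k) : Matrix (Fin 2) (Fin 2) k) =
        (P : Matrix (Fin 2) (Fin 2) k) * Matrix.diagonal ![(1 : k), (η τ : k)] *
          ((P⁻¹ : GL (Fin 2) k) : Matrix (Fin 2) (Fin 2) k))
    (hne : ∃ τ, η τ ≠ 1) :
    ρ.toGaloisRep.codimFixed (𝔓.inertia (absoluteGaloisGroup K)) = 1 := by
  set F := ρ.toGaloisRep.fixedSubmodule (𝔓.inertia (absoluteGaloisGroup K)) with hFdef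
  set e : Fin 2 → k := (P : Matrix (Fin 2) (Fin 2) k).mulVec (Pi.single 0 1) with hedef
  -- `P e₀ ∈ F`, `P e₀ ≠ 0`
  have he : e ∈ F := by
    rw [hFdef, ContinuousRep.mem_fixedSubmodule]
    intro h hh
    change ((ρ h : GL (Fin 2) k) : Matrix (Fin 2) (Fin 2) k).mulVec e = e
    rw [show h = ((⟨h, hh⟩ : 𝔓.inertia (absoluteGaloisGroup K)) : absoluteGaloisGroup K) from rfl,
      hPη ⟨h, hh⟩, hedef]
    exact conj_diagonal_mulVec_col_zero P _
  have he0 : e ≠ 0 := mulVec_col_zero_ne_zero P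
  -- `F ≠ ⊤`
  obtain ⟨τ₀, hτ₀⟩ := hne
  have hFtop : F ≠ ⊤ := by
    intro htop
    rw [hFdef, ContinuousRep.fixedSubmodule_eq_top_iff] at htop
    have h1 := htop (τ₀ : absoluteGaloisGroup K) τ₀.2
    have h2 : Matrix.toLin' ((ρ (τ₀ : absoluteGaloisGroup K) : GL (Fin 2) k) :
        Matrix (Fin 2) (Fin 2) k) = Matrix.toLin' 1 := by
      rw [Matrix.toLin'_one]
      refine LinearMap.ext fun w => ?_
      simpa using congr($h1 w)
    have h3 : ((ρ (τ₀ : absoluteGaloisGroup K) : GL (Fin 2) k) : Matrix (Fin 2) (Fin 2) k) = 1 :=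
      Matrix.toLin'.injective h2
    rw [hPη τ₀] at h3
    exact hτ₀ (Units.val_eq_one.mp (eq_one_of_conj_diagonal_eq_one P h3))
  -- dimension count
  have hlt : Module.finrank k F < 2 := by
    have := Submodule.finrank_lt hFtop
    rwa [Module.finrank_fin_fun] at this
  have hge : 1 ≤ Module.finrank k F := by
    rw [← finrank_span_singleton (K := k) he0]
    exact Submodule.finrank_mono ((Submodule.span_singleton_le_iff_mem e F).mpr he)
  have hF1 : Module.finrank k F = 1 := by omega
  rw [ContinuousRep.codimFixed_eq_finrank_sub, Module.finrank_fin_fun, ← hFdef, hF1]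

/-! ## The stub -/

/-- **Stub (conductor).** A continuous `ρ : Γ_ℚ → GL₂(k)` with open kernel, unramified away from
the place `v₀` of residue characteristic `p`, whose inertia groups above `v₀` act as
`P · diag(1, η) · P⁻¹` with `η` non-trivial of order prime to `p`, has Artin conductor exactly `p`
(`a_{v₀} = codim V^{I} + Swan = 1 + 0`, `a_v = 0` elsewhere; Serre, *Local Fields* VI §2).
[cite: SerreLocalFields1979, Ch. VI §2, Cor. 1'] -/
theorem stub_conductor (k : Type) [Field k] [CharZero k] [TopologicalSpace k] [IsTopologicalRing k]
    [T2Space k] (ρ : FramedGaloisRep ℚ k 2)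
    (hker : IsOpen ((ρ.toMonoidHom.ker : Subgroup (absoluteGaloisGroup ℚ)) :
      Set (absoluteGaloisGroup ℚ)))
    (p : ℕ) (hp : p.Prime) (v₀ : HeightOneSpectrum (𝓞 ℚ)) (hv₀ : ((p : ℕ) : 𝓞 ℚ) ∈ v₀.asIdeal)
    (hunr : ∀ v : HeightOneSpectrum (𝓞 ℚ), v ≠ v₀ → ρ.IsUnramifiedAt v)
    (hshape : ∀ 𝔓 ∈ v₀.primesAbove, ∃ (P : GL (Fin 2) k)
        (η : 𝔓.inertia (absoluteGaloisGroup ℚ) →* kˣ),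
        (∀ τ : 𝔓.inertia (absoluteGaloisGroup ℚ),
          ((ρ (τ : absoluteGaloisGroup ℚ) : GL (Fin 2) k) : Matrix (Fin 2) (Fin 2) k) =
            (P : Matrix (Fin 2) (Fin 2) k) * Matrix.diagonal ![(1 : k), (η τ : k)] *
              ((P⁻¹ : GL (Fin 2) k) : Matrix (Fin 2) (Fin 2) k)) ∧
        (∃ τ, η τ ≠ 1) ∧ (∀ τ, p.Coprime (orderOf (η τ)))) :
    ρ.toGaloisRep.artinConductorNat = p := by
  classical
  -- the prime above `v₀` used in the definition of `a_{v₀}`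
  have h𝔓₁ : (HeightOneSpectrum.primesAbove_nonempty v₀).some ∈ v₀.primesAbove :=
    (HeightOneSpectrum.primesAbove_nonempty v₀).some_mem
  obtain ⟨P, η, hPη, hne, hcop⟩ := hshape _ h𝔓₁
  -- `a_{v₀} = ⌊1 + 0⌋₊ = 1`
  have ha₀ : ρ.toGaloisRep.artinConductorExponent v₀ = 1 := by
    rw [GaloisRep.artinConductorExponent, GaloisRep.artinConductorAt_def,
      (isTameAt_of_inertia_shape ρ hker hv₀ h𝔓₁ P η hPη hcop).swanConductorAt_eq_zero, add_zero,
      Nat.floor_natCast, codimFixed_inertia_eq_one_of_shape ρ P η hPη hne]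
  -- `a_v = 0` for `v ≠ v₀`
  have ha : ∀ v : HeightOneSpectrum (𝓞 ℚ), v ≠ v₀ → ρ.toGaloisRep.artinConductorExponent v = 0 :=
    fun v hv => GaloisRep.artinConductorExponent_eq_zero_of_isUnramifiedAt_holds
      ((FramedGaloisRep.isUnramifiedAt_toGaloisRep_iff v ρ).mpr (hunr v hv))
  -- `𝔣(ρ) = v₀`
  have hcond : ρ.toGaloisRep.artinConductor = v₀.asIdeal := by
    rw [GaloisRep.artinConductor,
      finprod_eq_single (fun v : HeightOneSpectrum (𝓞 ℚ) =>
        v.asIdeal ^ ρ.toGaloisRep.artinConductorExponent v) v₀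
        (fun v hv => by rw [ha v hv, pow_zero]), ha₀, pow_one]
  rw [GaloisRep.artinConductorNat, hcond]
  exact Rat.residueCard_eq_of_natCast_mem hp hv₀

end Summit.Langlands.Langlands.Theorems.QuarterDeficit1951

end
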